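import Summits.Ventures.CertifiedManyBodySolver.Upper.UMPSPolarTensor
import Summits.Ventures.CertifiedManyBodySolver.Upper.UMPSEnergyBound
import HarnessLib

/-!
# uMPS dual certificates from DYADIC tensors, II: the polar correction (METHOD-umps §3, Lemma P)

HONEST FRAMING: first certified bounds; not a superconductivity verdict; every number certified or
labelled float.

Venture `Ventures/CertifiedManyBodySolver` (sr-mbsolver), U1-LEMMAS L9, part II (part I:
`UMPSPolarTensor.lean`). The verifiers compute, in exact arithmetic, the max row sum
`ε₀ = ‖G - 1‖_∞` of the Gram matrix `G = Σ_s (A s)ᴴ (A s)` of the STORED dyadic tensor `A` and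
certify `(q - η)·1 - W(A; X, Z) ⪰ 0`. This file proves that the polar tensor `Ã = polarTensor A`
(exactly isometric, part I) satisfies `q·1 - W(Ã; X, Z) ⪰ 0` as soon as
`η ≥ (1 + s₁)·δ·a₁²·(γ(1 + a₁²) + z)`, `a₁² = 1 + ε₀`, `s₁ = 1/(1 - ε₀)`, `δ = ε₀/(1 - ε₀)`, where
`γ·1 ± X ⪰ 0` and `z·1 ± Z ⪰ 0` (e.g. `γ`, `z` the max row sums of `|X|`, `|Z|`:
`polarTensor_dual_certificate_of_rowSum`) — EXACTLY the rational `η` of `HOME/var/METHOD-umps.md`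
§3 that the three readers print (`eta_exact`), with no operator norm anywhere: every estimate is a
Loewner-order inequality. The two outputs (`Σ (Ã s)ᴴ(Ã s) = 1`, `c·1 - W(Ã;X,Z) ⪰ 0`) are the two
hypotheses of `re_sum_star_mpsOpen_dotProduct_bondSum_mulVec_le` (`UMPSDualBound.lean`).

Proof (METHOD-umps §3 recast in the Loewner order). With `S = G^{-1/2} = 1 + T`, `TᴴT ≤ δ²·1`
and `SGS = 1`: `W(Ã) - W(A) = (SY'S - Y') + (Y' - Y) + (SΦS - Φ)` where `Φ = Φ_A(Z)`,
`Y = Vᴴ(X ⊗ 1)V`, `Y' = V'ᴴ(X ⊗ 1)V'`, `V = [A p₁ A p₂]`, `V' = [A p₁ S A p₂]`; `V'ᴴV' = Φ_A(SGS) = G`,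
`P = V' - V = [A p₁ T A p₂]` has `PᴴP = Φ_A(TᴴGT) ≤ (a₁²δ)²·1`, `Q = (V'+V)/2` has
`QᴴQ ≤ (a₁²(1+δ/2))²·1`; the first and third terms are bounded by the congruence-perturbation
bound `(1+T)ᴴX(1+T) - X ≤ ξδ(2+δ)·1`, the middle one by the polarisation bound
`PᴴXQ + QᴴXP ≤ 2ξpq·1`; total `δ(2+δ)·a₁²·(γ(1+a₁²) + z)` and `2 + δ = 1 + s₁`.

References: VAR team, `HOME/var/METHOD-umps.md` v1.1 §3 (Lemma P) and `HOME/var/U1-LEMMAS.md` L9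
(sr-mbsolver, 2026-08-20); R. A. Horn, C. R. Johnson, *Matrix Analysis* (2013) Thm. 7.7.2 (a),
Cor. 6.1.5.
-/

noncomputable section

open Matrix Finset
open scoped ComplexOrder MatrixOrder Kronecker BigOperators

namespace Summit.Ventures.CertifiedManyBodySolver.Upper

open Literature.MathematicalPhysics.QuantumLattice Literature.LinearAlgebra.Matrix
open Literature.LinearAlgebra.Matrix.PolarOrthonormalization
open Literature.MathematicalPhysics.QuantumLattice.ThermodynamicLimit

variable {q D : ℕ}

/-- **The polar-correction perturbation bound (METHOD-umps §3, Lemma P, Loewner form).**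
With `(1-ε)·1 ≤ G ≤ (1+ε)·1`, `0 ≤ ε < 1`, `-γ·1 ≤ X ≤ γ·1`, `-z·1 ≤ Z ≤ z·1`, `γ, z ≥ 0`:
`W(Ã; X, Z) - W(A; X, Z) ≤ (1 + 1/(1-ε))·(ε/(1-ε))·(1+ε)·(γ(1 + (1+ε)) + z)·1`. -/
theorem dualMatrix_polarTensor_sub_le {A : MPSTensor q D} {ε γ z : ℝ} (hε0 : 0 ≤ ε) (hε1 : ε < 1)
    (hγ : 0 ≤ γ) (hz : 0 ≤ z)
    (hlo : ((1 - ε : ℝ) : ℂ) • (1 : Matrix (Fin D) (Fin D) ℂ) ≤ gram A)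
    (hhi : gram A ≤ ((1 + ε : ℝ) : ℂ) • (1 : Matrix (Fin D) (Fin D) ℂ))
    {X : Matrix (Fin q × Fin q) (Fin q × Fin q) ℂ}
    (hX₁ : X ≤ (γ : ℂ) • (1 : Matrix (Fin q × Fin q) (Fin q × Fin q) ℂ))
    (hX₂ : -((γ : ℂ) • (1 : Matrix (Fin q × Fin q) (Fin q × Fin q) ℂ)) ≤ X)
    {Z : Matrix (Fin D) (Fin D) ℂ}
    (hZ₁ : Z ≤ (z : ℂ) • (1 : Matrix (Fin D) (Fin D) ℂ))
    (hZ₂ : -((z : ℂ) • (1 : Matrix (Fin D) (Fin D) ℂ)) ≤ Z) :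
    dualMatrix (polarTensor A) X Z - dualMatrix A X Z ≤
      (((1 + 1 / (1 - ε)) * (ε / (1 - ε)) * (1 + ε) * (γ * (1 + (1 + ε)) + z) : ℝ) : ℂ) •
        (1 : Matrix (Fin D) (Fin D) ℂ) := by
  -- names
  set G := gram A with hGdef
  set S := invSqrt G with hSdef
  set T := S - 1 with hTdef
  set a : ℝ := 1 + ε with hadef
  set δ : ℝ := ε / (1 - ε) with hδdef
  have h1ε : 0 < 1 - ε := by linarith
  have ha0 : 0 ≤ a := by rw [hadef]; linarith
  have hδ0 : 0 ≤ δ := div_nonneg hε0 h1ε.le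
  have hGh : G.IsHermitian := gram_isHermitian A
  have hSh : Sᴴ = S := conjTranspose_invSqrt G
  have hS1T : 1 + T = S := by rw [hTdef]; abel
  have hpos : ∀ x ∈ spectrum ℝ G, 0 < x := fun x hx =>
    lt_of_lt_of_le h1ε (le_of_mem_spectrum_of_smul_one_le hlo x hx)
  have hSGS : S * G * S = 1 := invSqrt_mul_self_mul_invSqrt hGh hpos
  have hTT : Tᴴ * T ≤ ((δ ^ 2 : ℝ) : ℂ) • (1 : Matrix (Fin D) (Fin D) ℂ) :=
    invSqrt_sub_one_sq_le_of_near_one' hε0 hε1 hlo hhi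
  -- (1) the `Z`-term: `S Φ S - Φ ≤ (z a) δ (2+δ)·1`
  set Φ := heisenberg A Z with hΦdef
  have hΦ₁ : Φ ≤ ((z * a : ℝ) : ℂ) • (1 : Matrix (Fin D) (Fin D) ℂ) := heisenberg_le_smul_one A hz hZ₁ hhi
  have hΦ₂ : -(((z * a : ℝ) : ℂ) • (1 : Matrix (Fin D) (Fin D) ℂ)) ≤ Φ :=
    neg_smul_one_le_heisenberg A hz hZ₂ hhi
  have hZterm : S * Φ * S - Φ ≤ ((z * a * δ * (2 + δ) : ℝ) : ℂ) • (1 : Matrix (Fin D) (Fin D) ℂ) := by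
    have h := conj_sub_self_le (mul_nonneg hz ha0) hδ0 hΦ₁ hΦ₂ hTT
    rwa [hS1T, hSh] at h
  -- (2) the bond terms. `𝕏 = X ⊗ 1`, `V = [A p₁ A p₂]`, `V' = [A p₁ S A p₂]`, `P = V' - V`, `Q = (V'+V)/2`
  set 𝕏 : Matrix ((Fin q × Fin q) × Fin D) ((Fin q × Fin q) × Fin D) ℂ :=
    X ⊗ₖ (1 : Matrix (Fin D) (Fin D) ℂ) with h𝕏def
  have h𝕏₁ : 𝕏 ≤ (γ : ℂ) • 1 := kronecker_one_le_smul_one hX₁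
  have h𝕏₂ : -((γ : ℂ) • 1) ≤ 𝕏 := neg_smul_one_le_kronecker_one hX₂
  set V : Matrix ((Fin q × Fin q) × Fin D) (Fin D) ℂ :=
    stack (fun p : Fin q × Fin q => A p.1 * 1 * A p.2) with hVdef
  set V' : Matrix ((Fin q × Fin q) × Fin D) (Fin D) ℂ :=
    stack (fun p : Fin q × Fin q => A p.1 * S * A p.2) with hV'def
  set M : Matrix (Fin D) (Fin D) ℂ := 1 + ((2⁻¹ : ℝ) : ℂ) • T with hMdef
  set P : Matrix ((Fin q × Fin q) × Fin D) (Fin D) ℂ :=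
    stack (fun p : Fin q × Fin q => A p.1 * T * A p.2) with hPdef
  set Q : Matrix ((Fin q × Fin q) × Fin D) (Fin D) ℂ :=
    stack (fun p : Fin q × Fin q => A p.1 * M * A p.2) with hQdef
  have hc2 : ((2⁻¹ : ℝ) : ℂ) = (2 : ℂ)⁻¹ := by rw [Complex.ofReal_inv, Complex.ofReal_ofNat]
  have hV'PQ : V' = Q + ((2⁻¹ : ℝ) : ℂ) • P := by
    rw [hQdef, hPdef, hV'def, ← stack_smul, ← stack_add]
    congr 1
    funext p
    rw [hMdef, ← hS1T, hc2]
    simp only [Matrix.mul_add, Matrix.add_mul, Matrix.mul_smul, Matrix.smul_mul, Matrix.mul_one]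
    module
  have hVPQ : V = Q - ((2⁻¹ : ℝ) : ℂ) • P := by
    rw [hQdef, hPdef, hVdef, ← stack_smul, ← stack_sub]
    congr 1
    funext p
    rw [hMdef, hc2]
    simp only [Matrix.mul_add, Matrix.add_mul, Matrix.mul_smul, Matrix.smul_mul, Matrix.mul_one]
    module
  -- Gram-type identities
  have hV'V' : V'ᴴ * V' = G := by
    rw [hV'def, conjTranspose_stack_twoSite_mul, hSh, ← hGdef, hSGS, heisenberg_one]
  have hPP : Pᴴ * P = heisenberg A (Tᴴ * G * T) := by
    rw [hPdef, conjTranspose_stack_twoSite_mul]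
  have hQQ : Qᴴ * Q = heisenberg A (Mᴴ * G * M) := by
    rw [hQdef, conjTranspose_stack_twoSite_mul]
  -- bounds on `PᴴP` and `QᴴQ`
  have hTGT : Tᴴ * G * T ≤ ((a * δ ^ 2 : ℝ) : ℂ) • (1 : Matrix (Fin D) (Fin D) ℂ) :=
    conj_le_smul_one (μ := δ ^ 2) ha0 hhi T hTT
  have hPle : Pᴴ * P ≤ (((a * δ) ^ 2 : ℝ) : ℂ) • (1 : Matrix (Fin D) (Fin D) ℂ) := by
    rw [hPP]
    refine (heisenberg_le_smul_one A (mul_nonneg ha0 (sq_nonneg δ)) hTGT hhi).trans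
      (smul_one_le_smul_one_complex (le_of_eq ?_))
    ring
  have hMM : Mᴴ * M ≤ (((1 + δ / 2) ^ 2 : ℝ) : ℂ) • (1 : Matrix (Fin D) (Fin D) ℂ) := by
    -- `(1 + T/2)ᴴ 1 (1 + T/2) - 1 ≤ 1·(δ/2)(2 + δ/2)·1`
    have hone₁ : (1 : Matrix (Fin D) (Fin D) ℂ) ≤ ((1 : ℝ) : ℂ) • (1 : Matrix (Fin D) (Fin D) ℂ) := by
      rw [Complex.ofReal_one, one_smul]
    have hone₂ : -(((1 : ℝ) : ℂ) • (1 : Matrix (Fin D) (Fin D) ℂ)) ≤ (1 : Matrix (Fin D) (Fin D) ℂ) := by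
      rw [Complex.ofReal_one, one_smul, Matrix.le_iff, sub_neg_eq_add]
      exact PosSemidef.one.add PosSemidef.one
    have hD : (((2⁻¹ : ℝ) : ℂ) • T)ᴴ * (((2⁻¹ : ℝ) : ℂ) • T) ≤
        (((δ / 2) ^ 2 : ℝ) : ℂ) • (1 : Matrix (Fin D) (Fin D) ℂ) := by
      rw [conjTranspose_smul, Complex.star_def, Complex.conj_ofReal, Matrix.smul_mul, Matrix.mul_smul,
        smul_smul, ← Complex.ofReal_mul]
      refine (smul_le_smul_one_complex hTT (by positivity)).trans
        (smul_one_le_smul_one_complex (le_of_eq ?_))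
      ring
    have hδ2 : (0 : ℝ) ≤ δ / 2 := by positivity
    have h : (1 + ((2⁻¹ : ℝ) : ℂ) • T)ᴴ * 1 * (1 + ((2⁻¹ : ℝ) : ℂ) • T) - 1 ≤
        ((1 * (δ / 2) * (2 + δ / 2) : ℝ) : ℂ) • (1 : Matrix (Fin D) (Fin D) ℂ) :=
      conj_sub_self_le zero_le_one hδ2 hone₁ hone₂ hD
    rw [Matrix.mul_one, ← hMdef, sub_le_iff_le_add] at h
    refine h.trans ?_
    have hsum : ((1 * (δ / 2) * (2 + δ / 2) : ℝ) : ℂ) • (1 : Matrix (Fin D) (Fin D) ℂ) + 1 =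
        ((1 * (δ / 2) * (2 + δ / 2) + 1 : ℝ) : ℂ) • (1 : Matrix (Fin D) (Fin D) ℂ) := by
      rw [Complex.ofReal_add, Complex.ofReal_one, add_smul, one_smul]
    rw [hsum]
    exact smul_one_le_smul_one_complex (le_of_eq (by ring))
  have hMGM : Mᴴ * G * M ≤ ((a * (1 + δ / 2) ^ 2 : ℝ) : ℂ) • (1 : Matrix (Fin D) (Fin D) ℂ) :=
    conj_le_smul_one (μ := (1 + δ / 2) ^ 2) ha0 hhi M hMM
  have hQle : Qᴴ * Q ≤ (((a * (1 + δ / 2)) ^ 2 : ℝ) : ℂ) • (1 : Matrix (Fin D) (Fin D) ℂ) := by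
    rw [hQQ]
    refine (heisenberg_le_smul_one A (mul_nonneg ha0 (sq_nonneg _)) hMGM hhi).trans
      (smul_one_le_smul_one_complex (le_of_eq ?_))
    ring
  -- (2b) `Y' - Y ≤ 2 γ (aδ) (a(1+δ/2))·1`
  have hYdiff : V'ᴴ * 𝕏 * V' - Vᴴ * 𝕏 * V ≤
      ((2 * γ * (a * δ) * (a * (1 + δ / 2)) : ℝ) : ℂ) • (1 : Matrix (Fin D) (Fin D) ℂ) := by
    rw [hV'PQ, hVPQ, polar_identity]
    exact polarization_le_smul_one hγ (mul_nonneg ha0 hδ0) (mul_nonneg ha0 (by linarith)) h𝕏₁ h𝕏₂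
      hPle hQle
  -- (2a) `S Y' S - Y' ≤ (γ a) δ (2+δ)·1`
  have hY'₁ : V'ᴴ * 𝕏 * V' ≤ ((γ * a : ℝ) : ℂ) • (1 : Matrix (Fin D) (Fin D) ℂ) := by
    have h := conj_le_conj h𝕏₁ V'
    rw [Matrix.mul_smul, Matrix.mul_one, Matrix.smul_mul, hV'V'] at h
    exact h.trans (smul_le_smul_one_complex hhi hγ)
  have hY'₂ : -(((γ * a : ℝ) : ℂ) • (1 : Matrix (Fin D) (Fin D) ℂ)) ≤ V'ᴴ * 𝕏 * V' := by
    have h := conj_le_conj h𝕏₂ V'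
    rw [Matrix.mul_neg, Matrix.neg_mul, Matrix.mul_smul, Matrix.mul_one, Matrix.smul_mul, hV'V'] at h
    exact (neg_le_neg (smul_le_smul_one_complex hhi hγ)).trans h
  have hY'term : S * (V'ᴴ * 𝕏 * V') * S - V'ᴴ * 𝕏 * V' ≤
      ((γ * a * δ * (2 + δ) : ℝ) : ℂ) • (1 : Matrix (Fin D) (Fin D) ℂ) := by
    have h := conj_sub_self_le (mul_nonneg hγ ha0) hδ0 hY'₁ hY'₂ hTT
    rwa [hS1T, hSh] at h
  -- (3) assemble
  have hsplit : dualMatrix (polarTensor A) X Z - dualMatrix A X Z =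
      (S * (V'ᴴ * 𝕏 * V') * S - V'ᴴ * 𝕏 * V') + (V'ᴴ * 𝕏 * V' - Vᴴ * 𝕏 * V) + (S * Φ * S - Φ) := by
    rw [dualMatrix, dualMatrix, bondImage_polarTensor, heisenberg_polarTensor, bondImage_eq_stack A X]
    abel
  rw [hsplit]
  refine ((add_le_add (add_le_add hY'term hYdiff) hZterm)).trans ?_
  rw [← add_smul, ← add_smul, ← Complex.ofReal_add, ← Complex.ofReal_add]
  refine smul_one_le_smul_one_complex (le_of_eq ?_)
  rw [hadef, hδdef]
  field_simp
  ring

/-- **Lemma P / U1-LEMMAS L9 (PSD-sandwich form).** For a dyadic tensor `A` with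
`‖Σ_s (A s)ᴴ(A s) - 1‖_∞ ≤ ε < 1` (max row sum), a two-site matrix `X` with `γ·1 ± X ⪰ 0`, any `Z`
with `z·1 ± Z ⪰ 0` (`γ, z ≥ 0`), any `η ≥ (1 + 1/(1-ε))·(ε/(1-ε))·(1+ε)·(γ(1+(1+ε)) + z)`
(METHOD-umps §3: `(1+s₁) δ a₁² (‖g‖(1+a₁²) + ‖Z‖)`), and a certified `(c - η)·1 - W(A; X, Z) ⪰ 0`:
the polar tensor `Ã = polarTensor A` is EXACTLY left-isometric and `c·1 - W(Ã; X, Z) ⪰ 0` — the two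
hypotheses of `re_sum_star_mpsOpen_dotProduct_bondSum_mulVec_le`. -/
theorem polarTensor_dual_certificate {A : MPSTensor q D} {ε γ z η c : ℝ} (hε0 : 0 ≤ ε) (hε1 : ε < 1)
    (hγ : 0 ≤ γ) (hz : 0 ≤ z)
    (hG : ∀ i, ∑ j, ‖(gram A - 1) i j‖ ≤ ε)
    {X : Matrix (Fin q × Fin q) (Fin q × Fin q) ℂ} {Z : Matrix (Fin D) (Fin D) ℂ}
    (hX₁ : ((γ : ℂ) • (1 : Matrix (Fin q × Fin q) (Fin q × Fin q) ℂ) - X).PosSemidef)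
    (hX₂ : ((γ : ℂ) • (1 : Matrix (Fin q × Fin q) (Fin q × Fin q) ℂ) + X).PosSemidef)
    (hZ₁ : ((z : ℂ) • (1 : Matrix (Fin D) (Fin D) ℂ) - Z).PosSemidef)
    (hZ₂ : ((z : ℂ) • (1 : Matrix (Fin D) (Fin D) ℂ) + Z).PosSemidef)
    (hη : (1 + 1 / (1 - ε)) * (ε / (1 - ε)) * (1 + ε) * (γ * (1 + (1 + ε)) + z) ≤ η)
    (hW : (((c - η : ℝ) : ℂ) • (1 : Matrix (Fin D) (Fin D) ℂ) - dualMatrix A X Z).PosSemidef) :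
    (∑ s, (polarTensor A s)ᴴ * polarTensor A s = 1) ∧
      (((c : ℂ)) • (1 : Matrix (Fin D) (Fin D) ℂ) - dualMatrix (polarTensor A) X Z).PosSemidef := by
  refine ⟨sum_conjTranspose_polarTensor_mul_self hε1 hG, ?_⟩
  obtain ⟨hlo, hhi⟩ := near_one_of_rowSum_le (gram_isHermitian A) hG
  have hX₁' : X ≤ (γ : ℂ) • 1 := Matrix.le_iff.mpr hX₁
  have hX₂' : -((γ : ℂ) • 1) ≤ X := by
    rw [Matrix.le_iff, sub_neg_eq_add, add_comm]; exact hX₂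
  have hZ₁' : Z ≤ (z : ℂ) • 1 := Matrix.le_iff.mpr hZ₁
  have hZ₂' : -((z : ℂ) • 1) ≤ Z := by
    rw [Matrix.le_iff, sub_neg_eq_add, add_comm]; exact hZ₂
  have hdiff := dualMatrix_polarTensor_sub_le hε0 hε1 hγ hz hlo hhi hX₁' hX₂' hZ₁' hZ₂'
  have hW' : dualMatrix A X Z ≤ ((c - η : ℝ) : ℂ) • 1 := Matrix.le_iff.mpr hW
  have hη' : (((1 + 1 / (1 - ε)) * (ε / (1 - ε)) * (1 + ε) * (γ * (1 + (1 + ε)) + z) : ℝ) : ℂ) •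
      (1 : Matrix (Fin D) (Fin D) ℂ) ≤ ((η : ℝ) : ℂ) • (1 : Matrix (Fin D) (Fin D) ℂ) :=
    smul_one_le_smul_one_complex hη
  have h2 : dualMatrix (polarTensor A) X Z - dualMatrix A X Z ≤
      ((η : ℝ) : ℂ) • (1 : Matrix (Fin D) (Fin D) ℂ) := hdiff.trans hη'
  have h3 : dualMatrix (polarTensor A) X Z ≤
      ((c - η : ℝ) : ℂ) • (1 : Matrix (Fin D) (Fin D) ℂ) + ((η : ℝ) : ℂ) • (1 : Matrix (Fin D) (Fin D) ℂ) := by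
    have := add_le_add hW' h2
    rwa [add_sub_cancel] at this
  rw [← add_smul, ← Complex.ofReal_add, sub_add_cancel] at h3
  exact Matrix.le_iff.mp h3

/-- **Lemma P / U1-LEMMAS L9 (max-row-sum form, the readers' numbers).** As
`polarTensor_dual_certificate`, with the PSD sandwiches on `X` and `Z` replaced by Hermitian-ness
and max row sums `Σ_{p'} ‖X p p'‖ ≤ γ`, `Σ_j ‖Z i j‖ ≤ z` (`g_inf`, `Z_inf` of the verifiers). -/
theorem polarTensor_dual_certificate_of_rowSum {A : MPSTensor q D} {ε γ z η c : ℝ} (hε0 : 0 ≤ ε)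
    (hε1 : ε < 1) (hγ : 0 ≤ γ) (hz : 0 ≤ z)
    (hG : ∀ i, ∑ j, ‖(gram A - 1) i j‖ ≤ ε)
    {X : Matrix (Fin q × Fin q) (Fin q × Fin q) ℂ} (hXh : X.IsHermitian) (hX : ∀ p, ∑ p', ‖X p p'‖ ≤ γ)
    {Z : Matrix (Fin D) (Fin D) ℂ} (hZh : Z.IsHermitian) (hZ : ∀ i, ∑ j, ‖Z i j‖ ≤ z)
    (hη : (1 + 1 / (1 - ε)) * (ε / (1 - ε)) * (1 + ε) * (γ * (1 + (1 + ε)) + z) ≤ η)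
    (hW : (((c - η : ℝ) : ℂ) • (1 : Matrix (Fin D) (Fin D) ℂ) - dualMatrix A X Z).PosSemidef) :
    (∑ s, (polarTensor A s)ᴴ * polarTensor A s = 1) ∧
      (((c : ℂ)) • (1 : Matrix (Fin D) (Fin D) ℂ) - dualMatrix (polarTensor A) X Z).PosSemidef ∧
      (((z : ℂ) • (1 : Matrix (Fin D) (Fin D) ℂ) - Z).PosSemidef) ∧
      (((z : ℂ) • (1 : Matrix (Fin D) (Fin D) ℂ) + Z).PosSemidef) := by
  have hX₁ : ((γ : ℂ) • (1 : Matrix (Fin q × Fin q) (Fin q × Fin q) ℂ) - X).PosSemidef :=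
    Matrix.le_iff.mp (le_smul_one_of_rowSum_le hXh hX)
  have hX₂ : ((γ : ℂ) • (1 : Matrix (Fin q × Fin q) (Fin q × Fin q) ℂ) + X).PosSemidef := by
    have h := Matrix.le_iff.mp (neg_smul_one_le_of_rowSum_le hXh hX)
    rwa [sub_neg_eq_add, add_comm] at h
  have hZ₁ : ((z : ℂ) • (1 : Matrix (Fin D) (Fin D) ℂ) - Z).PosSemidef :=
    Matrix.le_iff.mp (le_smul_one_of_rowSum_le hZh hZ)
  have hZ₂ : ((z : ℂ) • (1 : Matrix (Fin D) (Fin D) ℂ) + Z).PosSemidef := by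
    have h := Matrix.le_iff.mp (neg_smul_one_le_of_rowSum_le hZh hZ)
    rwa [sub_neg_eq_add, add_comm] at h
  obtain ⟨h1, h2⟩ := polarTensor_dual_certificate hε0 hε1 hγ hz hG hX₁ hX₂ hZ₁ hZ₂ hη hW
  exact ⟨h1, h2, hZ₁, hZ₂⟩

/-! ### Theorem U1 from a DYADIC certificate (ncell = 1, d = 4) -/

/-- **Theorem U1 for the stored dyadic tensor** (`hubbardChainEnergyDensity_le_of_umps_dual` ∘
`polarTensor_dual_certificate`). Readers' inputs: the dyadic `A : Fin 4 → M_D(ℂ)` (`D ≥ 1`), the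
max row sum `ε` of `Σ_s (A s)ᴴ(A s) - 1` (`eps0_exact < 1`), `γ ≥ 0` with `γ·1 ± g ⪰ 0` for
`g = bondMatrix t U` (e.g. `γ = ‖g‖_∞`), any `Z` with `z·1 ± Z ⪰ 0` (`z ≥ 0`), a rational
`η ≥ (1 + 1/(1-ε))·(ε/(1-ε))·(1+ε)·(γ(1+(1+ε)) + z)` (METHOD-umps §3), and the exact-arithmetic
certificate `(q - η)·1 - W(A; g, Z) ⪰ 0`. Conclusion: `hubbardChainEnergyDensity t U ≤ q`. -/
theorem hubbardChainEnergyDensity_le_of_umps_dual_dyadic (A : MPSTensor 4 D) (hD : 0 < D)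
    {ε γ z η q : ℝ} (hε0 : 0 ≤ ε) (hε1 : ε < 1) (hγ : 0 ≤ γ) (hz : 0 ≤ z)
    (hG : ∀ i, ∑ j, ‖(gram A - 1) i j‖ ≤ ε) (t : ℝ) {U : ℝ} (hU : 0 ≤ U)
    (hX₁ : ((γ : ℂ) • (1 : Matrix (Fin 4 × Fin 4) (Fin 4 × Fin 4) ℂ) - bondMatrix t U).PosSemidef)
    (hX₂ : ((γ : ℂ) • (1 : Matrix (Fin 4 × Fin 4) (Fin 4 × Fin 4) ℂ) + bondMatrix t U).PosSemidef)
    (Z : Matrix (Fin D) (Fin D) ℂ)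
    (hZ₁ : ((z : ℂ) • (1 : Matrix (Fin D) (Fin D) ℂ) - Z).PosSemidef)
    (hZ₂ : ((z : ℂ) • (1 : Matrix (Fin D) (Fin D) ℂ) + Z).PosSemidef)
    (hη : (1 + 1 / (1 - ε)) * (ε / (1 - ε)) * (1 + ε) * (γ * (1 + (1 + ε)) + z) ≤ η)
    (hW : (((q - η : ℝ) : ℂ) • (1 : Matrix (Fin D) (Fin D) ℂ) -
      dualMatrix A (bondMatrix t U) Z).PosSemidef) :
    hubbardChainEnergyDensity t U ≤ q := by
  obtain ⟨hA, hW'⟩ := polarTensor_dual_certificate hε0 hε1 hγ hz hG hX₁ hX₂ hZ₁ hZ₂ hη hW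
  exact hubbardChainEnergyDensity_le_of_umps_dual (polarTensor A) hD hA t hU Z hW' hZ₁ hZ₂

/-- The same with max row sums for `g` and `Z` (`g_inf`, `Z_inf` of the verifiers) in place of the
PSD sandwiches. -/
theorem hubbardChainEnergyDensity_le_of_umps_dual_dyadic_of_rowSum (A : MPSTensor 4 D) (hD : 0 < D)
    {ε γ z η q : ℝ} (hε0 : 0 ≤ ε) (hε1 : ε < 1) (hγ : 0 ≤ γ) (hz : 0 ≤ z)
    (hG : ∀ i, ∑ j, ‖(gram A - 1) i j‖ ≤ ε) (t : ℝ) {U : ℝ} (hU : 0 ≤ U)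
    (hgh : (bondMatrix t U).IsHermitian) (hg : ∀ p, ∑ p', ‖bondMatrix t U p p'‖ ≤ γ)
    (Z : Matrix (Fin D) (Fin D) ℂ) (hZh : Z.IsHermitian) (hZ : ∀ i, ∑ j, ‖Z i j‖ ≤ z)
    (hη : (1 + 1 / (1 - ε)) * (ε / (1 - ε)) * (1 + ε) * (γ * (1 + (1 + ε)) + z) ≤ η)
    (hW : (((q - η : ℝ) : ℂ) • (1 : Matrix (Fin D) (Fin D) ℂ) -
      dualMatrix A (bondMatrix t U) Z).PosSemidef) :
    hubbardChainEnergyDensity t U ≤ q := by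
  obtain ⟨hA, hW', hZ₁, hZ₂⟩ :=
    polarTensor_dual_certificate_of_rowSum hε0 hε1 hγ hz hG hgh hg hZh hZ hη hW
  exact hubbardChainEnergyDensity_le_of_umps_dual (polarTensor A) hD hA t hU Z hW' hZ₁ hZ₂

end Summit.Ventures.CertifiedManyBodySolver.Upper

end
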